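import Literature.AlgebraicGeometry.Morphisms.CechUnitCocycleCoefficients
import Literature.RingTheory.Flat.SmallExtensionBaseChange
import HarnessLib

/-!
# The kernel map of an augmented small extension, read in the flat models `Γ(V) ⊗_A R`

For an AUGMENTED small extension `π : R → R₀`, `ρ : R → A` with framed kernel `e : A^d ≅ I = ker π`
(`Literature.RingTheory.Flat.IsSmallExtension`, residue ring `k = A`) and a scheme `f : X ⟶ Spec A`: `kerMapA` — the kernel
map `Γ(V)^d → Γ(V) ⊗ R`, `y ↦ Σ_ℓ y_ℓ ⊗ e(δ_ℓ)`; exactness `exists_kerMapA_eq`, injectivity `kerMapA_injective` (flatness),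
semilinearity `mul_kerMapA`, `I² = 0` (`kerMapA_mul_kerMapA`, `one_add_mul_one_add`, `isUnit_one_add`) — the line-bundle
content of [GortzWedhorn2023] Lemma 26.15 (`H¹(X₀, 𝓘) → Pic X → Pic X₀`) in cocycle form, step one.
HC_CM is proved only modulo the 7 printed citations until rung 0 closes.

## References
* [GortzWedhorn2023] U. Görtz, T. Wedhorn, *Algebraic Geometry II*, Lemma 26.15, Prop. 27.122 (`Lie(Pic_{X/S}) ≅ R¹f_*𝒪_X` via `U[ε]`).
* [MumfordAV1970] D. Mumford, *Abelian Varieties*, §13 (proof of the Thm. pp. 125–130).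
* The Stacks Project, Tag 08SP (deformations of invertible modules), Tag 01ED (Čech cohomology).
-/

noncomputable section

universe u v

open TensorProduct CategoryTheory AlgebraicGeometry
open Literature.RingTheory.Flat Literature.RingTheory.Flat.IsSmallExtension

namespace Literature.AlgebraicGeometry.Morphisms

namespace CechUnitCocycle

variable {A : Type u} [CommRing A] {X : Scheme.{u}} (f : X ⟶ Spec (.of A)) {ι : Type v} (U : ι → X.Opens)

/-! ## §3 The kernel map of an augmented small extension, read in `Γ(V)` -/

section SmallExt

variable {R R₀ : Type u} [CommRing R] [CommRing R₀] [Algebra A R] [Algebra A R₀]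
  {π : R →ₐ[A] R₀} {ρ : R →ₐ[A] A} {I : Ideal R} {d : ℕ} {e : (Fin d → A) ≃ₗ[A] I}

variable (e) in
/-- **The kernel map read in `Γ(V)`**: `y ↦ Σ_ℓ y_ℓ ⊗ e(δ_ℓ) ∈ Γ(V) ⊗_A R` (the tree's `IsSmallExtension.kerMap`
precomposed with `Γ(V) = Γ(V) ⊗_A A`). [folklore] -/
def kerMapA (V : X.Opens) (y : Fin d → Sections f V) : Sections f V ⊗[A] R :=
  kerMap e (Sections f V) (fun ℓ => y ℓ ⊗ₜ[A] (1 : A))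

/-- Unfolding of `kerMapA`. [cite: GortzWedhorn2023, Lemma 26.15] -/
theorem kerMapA_def (V : X.Opens) (y : Fin d → Sections f V) :
    kerMapA f e V y = kerMap e (Sections f V) (fun ℓ => y ℓ ⊗ₜ[A] (1 : A)) := rfl

variable {f}

/-- `kerMapA` is additive. [cite: GortzWedhorn2023, Lemma 26.15] -/
theorem kerMapA_add (V : X.Opens) (y y' : Fin d → Sections f V) :
    kerMapA f e V (y + y') = kerMapA f e V y + kerMapA f e V y' := by
  rw [kerMapA_def, kerMapA_def, kerMapA_def, ← map_add]
  congr 1; funext ℓ; simp [TensorProduct.add_tmul]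

/-- `kerMapA` at `0`. [cite: GortzWedhorn2023, Lemma 26.15] -/
@[simp] theorem kerMapA_zero (V : X.Opens) : kerMapA f e V (0 : Fin d → Sections f V) = 0 := by
  rw [kerMapA_def]
  have : (fun ℓ : Fin d => (0 : Fin d → Sections f V) ℓ ⊗ₜ[A] (1 : A)) = 0 := by
    funext ℓ; simp
  rw [this, map_zero]

/-- `kerMapA` is compatible with negation. [cite: GortzWedhorn2023, Lemma 26.15] -/
theorem kerMapA_neg (V : X.Opens) (y : Fin d → Sections f V) : kerMapA f e V (-y) = -kerMapA f e V y := by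
  have h := kerMapA_add (f := f) (e := e) V y (-y)
  rw [add_neg_cancel, kerMapA_zero] at h
  exact (neg_eq_of_add_eq_zero_right h.symm).symm

/-- `kerMapA` is compatible with subtraction. [cite: GortzWedhorn2023, Lemma 26.15] -/
theorem kerMapA_sub (V : X.Opens) (y y' : Fin d → Sections f V) :
    kerMapA f e V (y - y') = kerMapA f e V y - kerMapA f e V y' := by
  rw [sub_eq_add_neg, kerMapA_add, kerMapA_neg, ← sub_eq_add_neg]

/-- `kerMapA` is `A`-homogeneous. [cite: GortzWedhorn2023, Lemma 26.15] -/
theorem kerMapA_smul (V : X.Opens) (a : A) (y : Fin d → Sections f V) :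
    kerMapA f e V (a • y) = a • kerMapA f e V y := by
  rw [kerMapA_def, kerMapA_def]
  have : (fun ℓ => (a • y) ℓ ⊗ₜ[A] (1 : A)) = a • fun ℓ => y ℓ ⊗ₜ[A] (1 : A) := by
    funext ℓ; simp [TensorProduct.smul_tmul']
  rw [this, LinearMap.map_smul_of_tower]

/-- Naturality of `kerMapA` under restriction. [cite: GortzWedhorn2023, Lemma 26.15] -/
theorem resR_kerMapA {V W : X.Opens} (h : W ≤ V) (y : Fin d → Sections f V) :
    resR f R h (kerMapA f e V y) = kerMapA f e W (fun ℓ => Sections.res f h (y ℓ)) := by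
  rw [kerMapA_def, kerMapA_def, resR, map_kerMap]
  try (congr 1)

/-- **Injectivity** of `kerMapA` for `Γ(V)` flat over `A` (e.g. `A` a field). [cite: StacksProject, Tag 00HL] -/
theorem kerMapA_injective (V : X.Opens) [Module.Flat A (Sections f V)] :
    Function.Injective (kerMapA f e V) := by
  intro y y' h
  have h1 := kerMap_injective (e := e) (Sections f V) h
  funext ℓ
  have h2 := congrFun h1 ℓ
  simpa using congrArg (Algebra.TensorProduct.rid A A (Sections f V)) h2

variable (H : IsSmallExtension π ρ I e)
include H

/-- `id ⊗ π` kills `kerMapA`. [cite: GortzWedhorn2023, Lemma 26.15] -/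
theorem coef_kerMapA (V : X.Opens) (y : Fin d → Sections f V) : coef f π V (kerMapA f e V y) = 0 :=
  H.mapπ_kerMap (Sections f V) _

/-- **Exactness**: an element killed by `id ⊗ π` is in the image of `kerMapA`. [cite: GortzWedhorn2023, Lemma 26.15] -/
theorem exists_kerMapA_eq {V : X.Opens} {x : Sections f V ⊗[A] R} (hx : coef f π V x = 0) :
    ∃ y : Fin d → Sections f V, kerMapA f e V y = x := by
  obtain ⟨y', hy'⟩ := H.exists_kerMap_eq_of_mapπ_eq_zero (Sections f V) (x := x) hx
  refine ⟨fun ℓ => Algebra.TensorProduct.rid A A (Sections f V) (y' ℓ), ?_⟩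
  rw [← hy', kerMapA_def]
  congr 1; funext ℓ
  exact ((Algebra.TensorProduct.rid A A (Sections f V)).symm_apply_apply (y' ℓ))

/-- **Semilinearity**: `x · kerMapA(y) = kerMapA(x̄ · y)` with `x̄ = red ρ x ∈ Γ(V)`. [cite: GortzWedhorn2023, Lemma 26.15] -/
theorem mul_kerMapA (V : X.Opens) (x : Sections f V ⊗[A] R) (y : Fin d → Sections f V) :
    x * kerMapA f e V y = kerMapA f e V (fun ℓ => red f ρ V x * y ℓ) := by
  rw [kerMapA_def, kerMapA_def, H.mul_kerMap]
  congr 1; funext ℓ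
  have h1 : ∀ z : Sections f V ⊗[A] A, z = (Algebra.TensorProduct.rid A A (Sections f V) z) ⊗ₜ[A] (1 : A) :=
    fun z => ((Algebra.TensorProduct.rid A A (Sections f V)).symm_apply_apply z).symm
  conv_lhs => rw [h1 (mapρ ρ (Sections f V) x)]
  rw [Algebra.TensorProduct.tmul_mul_tmul, one_mul]
  rfl

variable {ρ₀ : R₀ →ₐ[A] A} (hρ : ρ₀.comp π = ρ)
include hρ

/-- The reduction of an element of `kerMapA` vanishes (`I ⊆ ker ρ`). [cite: GortzWedhorn2023, Lemma 26.15] -/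
theorem red_kerMapA (V : X.Opens) (y : Fin d → Sections f V) : red f ρ V (kerMapA f e V y) = 0 := by
  rw [← hρ, ← red_coef, coef_kerMapA H, map_zero]

/-- **`I² = 0`**: products of two elements of `kerMapA` vanish. [cite: GortzWedhorn2023, Lemma 26.15] -/
theorem kerMapA_mul_kerMapA (V : X.Opens) (y y' : Fin d → Sections f V) :
    kerMapA f e V y * kerMapA f e V y' = 0 := by
  rw [mul_kerMapA H, red_kerMapA H hρ]
  have : (fun ℓ => (0 : Sections f V) * y' ℓ) = 0 := by funext ℓ; simp
  rw [this, kerMapA_zero]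

/-- `(1 + κ y)(1 + κ y') = 1 + κ (y + y')`. [cite: GortzWedhorn2023, Lemma 26.15] -/
theorem one_add_mul_one_add (V : X.Opens) (y y' : Fin d → Sections f V) :
    (1 + kerMapA f e V y) * (1 + kerMapA f e V y') = 1 + kerMapA f e V (y + y') := by
  rw [kerMapA_add]
  have h0 := kerMapA_mul_kerMapA H hρ V y y'
  calc (1 + kerMapA f e V y) * (1 + kerMapA f e V y')
      = 1 + kerMapA f e V y + kerMapA f e V y' + kerMapA f e V y * kerMapA f e V y' := by ring
    _ = 1 + (kerMapA f e V y + kerMapA f e V y') := by rw [h0]; ring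

/-- `1 + κ y` is a unit with inverse `1 − κ y`. [cite: GortzWedhorn2023, Lemma 26.15] -/
theorem isUnit_one_add (V : X.Opens) (y : Fin d → Sections f V) : IsUnit (1 + kerMapA f e V y) := by
  refine IsUnit.of_mul_eq_one (1 + kerMapA f e V (-y)) ?_
  rw [one_add_mul_one_add H hρ, add_neg_cancel, kerMapA_zero, add_zero]

omit hρ in
/-- An element reducing to `1` along `π` is `1 + κ y`. [cite: GortzWedhorn2023, Lemma 26.15] -/
theorem exists_eq_one_add {V : X.Opens} {x : Sections f V ⊗[A] R} (hx : coef f π V x = 1) :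
    ∃ y : Fin d → Sections f V, x = 1 + kerMapA f e V y := by
  obtain ⟨y, hy⟩ := exists_kerMapA_eq H (x := x - 1) (by rw [map_sub, hx, map_one, sub_self])
  exact ⟨y, by rw [hy]; ring⟩

omit hρ in
/-- An element reducing to a unit along `π` is a unit. [cite: GortzWedhorn2023, Lemma 26.15] -/
theorem isUnit_of_coef {V : X.Opens} {x : Sections f V ⊗[A] R} (hx : IsUnit (coef f π V x)) (hρ : ρ₀.comp π = ρ) :
    IsUnit x := by
  refine H.isUnit_of_isUnit_mapρ (Sections f V) ?_
  have : mapρ ρ (Sections f V) x = coef f ρ₀ V (coef f π V x) := by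
    rw [← coef_comp, hρ]
  rw [this]
  exact hx.map _

end SmallExt

end CechUnitCocycle

end Literature.AlgebraicGeometry.Morphisms

end
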